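import Summits.QuantumFields.YangMills.Theorems.LuscherReductionRunningReductionTraceFormula
import Summits.QuantumFields.YangMills.Theorems.FemtoTransferGapLevelsDecay
import Summits.QuantumFields.YangMills.Theorems.FemtoTransferGapBounds

/-!
# Femto transfer gap — the EXCITED TRACE RATIO `E(L,β,T) = Z_phys(T)/λ₀^T − 1 = Σ_{k≥1}(λ_k/λ₀)^T` is dominated by its first term:
# `E(T) ≤ (λ₁/λ₀)^{T−2}·E(2)` (and `(λ₁/λ₀)^T ≤ E(T)`) on the femto window

Lead seat `ym-line-fcl-p1` (2026-08-28), for the `trace` lines of the step cruxes `OctaveStepDecay` (stmt-QuantumFields-24153) and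
`SubOctaveBounded` (stmt-QuantumFields-24085) of route `FemtoCutoffLadder` (planner ym-idea-1 g2, skeletons `Cruxes.OctaveStepDecay.Trace` /
`Cruxes.SubOctaveBounded.Trace`): their provable-now stub `stub_excitedRatioUpper : ExcitedRatioUpper` is, with the skeleton-local
`excitedRatio L β T := TT.physTrace L β T / topValue su2Rep L β ^ T − 1` UNFOLDED, exactly `physTrace_excited_upper` below (the by-name stub files
import this one).  Route-independent (no `Theses` import).

* `hasSum_excited` — `HasSum (k ↦ (λ_{k+1}/λ₀)^T) (Z_phys(T)/λ₀^T − 1)` for `T ≥ 2`, `β ≥ 1` (PROVED trace formula `TT.traceFormula_all` + `λ₀`-term split off);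
* ★ `physTrace_excited_upper` — `Z(T)/λ₀^T − 1 ≤ (λ₁/λ₀)^{T−2}·(Z(2)/λ₀² − 1)` on the window, `T ≥ 2` (`0 ≤ λ_{k+1} ≤ λ₁`: `levelValue_le_of_le`,
  `levelValue_pos_of_window`; termwise comparison of the two sums);
* `physTrace_excited_lower` — `(λ₁/λ₀)^T ≤ Z(T)/λ₀^T − 1` (drop the terms `k ≥ 2`).

HONEST FRAMING: fixed-lattice transfer-operator bookkeeping (any `L`, window couplings); it is not the two-cutoff comparison (the hard stubs
`stub_towerTraceComparison` / `stub_subOctaveTraceComparison`), and bears on neither infinite volume nor a mass gap nor Clay.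
No definitions, no named facts, no `sorry`.
-/

set_option autoImplicit false

noncomputable section

namespace Summit.QuantumFields.YangMills.Theorems.FemtoTransferGap

open Real

variable {L : ℕ} [NeZero L]

/-- **The excited part of the zero-flux trace as a series**: for `β ≥ 1`, `T ≥ 2`,
`Σ_{k≥0} (λ_{k+1}/λ₀)^T = Z_phys(L,β,T)/λ₀^T − 1` (trace formula, top term split off, `λ₀ > 0`). [cite: MontvayMunster1994, (3.145)] -/
theorem hasSum_excited {β : ℝ} (hβ : 1 ≤ β) {T : ℕ} (hT : 2 ≤ T) :
    HasSum (fun k : ℕ => (levelValue su2Rep L β (k + 1) / topValue su2Rep L β) ^ T)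
      (TT.physTrace L β T / topValue su2Rep L β ^ T - 1) := by
  have hb : 0 < topValue su2Rep L β := topValue_su2Rep_pos L β
  have hbT : topValue su2Rep L β ^ T ≠ 0 := (pow_pos hb T).ne'
  have h := (TT.traceFormula_all L β T hβ hT).div_const (topValue su2Rep L β ^ T)
  have hfun : (fun k : ℕ => levelValue su2Rep L β k ^ T / topValue su2Rep L β ^ T) =
      fun k : ℕ => (levelValue su2Rep L β k / topValue su2Rep L β) ^ T := by
    funext k; rw [div_pow]
  rw [hfun] at h
  have h1 := (hasSum_nat_add_iff' 1).mpr h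
  have h0 : (levelValue su2Rep L β 0 / topValue su2Rep L β) ^ T = 1 := by
    rw [levelValue_zero, div_self hb.ne', one_pow]
  simpa [Finset.sum_range_one, h0] using h1

/-- ★ **First-term domination of the excited trace ratio** (= the `trace` skeletons' stub `ExcitedRatioUpper`, unfolded): on the femto window and
for `T ≥ 2`, `Z(T)/λ₀^T − 1 ≤ (λ₁/λ₀)^{T−2}·(Z(2)/λ₀² − 1)` — since `0 ≤ λ_{k+1} ≤ λ₁` termwise `(λ_{k+1}/λ₀)^T ≤ (λ₁/λ₀)^{T−2}(λ_{k+1}/λ₀)²`.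
[cite: ReedSimonIV1978, Thm. XIII.1] [cite: MontvayMunster1994, (3.145)] -/
theorem physTrace_excited_upper {lam β : ℝ} (hW : InFemtoWindow lam β L) {T : ℕ} (hT : 2 ≤ T) :
    TT.physTrace L β T / topValue su2Rep L β ^ T - 1 ≤
      (secondValue su2Rep L β / topValue su2Rep L β) ^ (T - 2) * (TT.physTrace L β 2 / topValue su2Rep L β ^ 2 - 1) := by
  have hβ1 : 1 ≤ β := hW.1
  have hβ0 : 0 < β := by linarith
  have hb : 0 < topValue su2Rep L β := topValue_su2Rep_pos L β
  set r : ℕ → ℝ := fun k => levelValue su2Rep L β k / topValue su2Rep L β with hr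
  have hr0 : ∀ k, 0 ≤ r k := fun k => div_nonneg (levelValue_pos_of_window hW k).le hb.le
  have hr1 : ∀ k, r (k + 1) ≤ r 1 := fun k =>
    div_le_div_of_nonneg_right (levelValue_le_of_le hβ0 (by omega : 1 ≤ k + 1)) hb.le
  have hT' := hasSum_excited (L := L) hβ1 hT
  have h2 := hasSum_excited (L := L) hβ1 (le_refl 2)
  have hmul := h2.mul_left (r 1 ^ (T - 2))
  rw [← levelValue_one]
  refine hasSum_le (fun k => ?_) hT' hmul
  show r (k + 1) ^ T ≤ r 1 ^ (T - 2) * r (k + 1) ^ 2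
  have hsplit : r (k + 1) ^ T = r (k + 1) ^ (T - 2) * r (k + 1) ^ 2 := by
    rw [← pow_add]; congr 1; omega
  rw [hsplit]
  exact mul_le_mul_of_nonneg_right (pow_le_pow_left₀ (hr0 _) (hr1 k) _) (sq_nonneg _)

/-- **The first term is below the excited trace ratio**: `(λ₁/λ₀)^T ≤ Z(T)/λ₀^T − 1` on the window, `T ≥ 2` (all other terms are `≥ 0`).
[cite: MontvayMunster1994, (3.145)] -/
theorem physTrace_excited_lower {lam β : ℝ} (hW : InFemtoWindow lam β L) {T : ℕ} (hT : 2 ≤ T) :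
    (secondValue su2Rep L β / topValue su2Rep L β) ^ T ≤ TT.physTrace L β T / topValue su2Rep L β ^ T - 1 := by
  have hb : 0 < topValue su2Rep L β := topValue_su2Rep_pos L β
  have h := hasSum_excited (L := L) hW.1 hT
  have hnn : ∀ k ∉ ({0} : Finset ℕ), 0 ≤ (levelValue su2Rep L β (k + 1) / topValue su2Rep L β) ^ T :=
    fun k _ => pow_nonneg (div_nonneg (levelValue_pos_of_window hW (k + 1)).le hb.le) T
  have hle := sum_le_hasSum ({0} : Finset ℕ) hnn h
  rw [Finset.sum_singleton, zero_add, levelValue_one] at hle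
  exact hle

end Summit.QuantumFields.YangMills.Theorems.FemtoTransferGap

end
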